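import Summits.Ventures.DiscreteObjects.Hadamard.ConferenceGraph333FixedSubgraph

/-!
# Fixed points of p-GROUPS of automorphisms of srg(333,166,82,83): congruences mod p; ORDER 25 and ORDER 81 EXCLUDED,
# order 9 ⇒ f ∈ {9,15,21,27,33}, order 27 ⇒ f = 9 (kernel)

Framing: lottery ticket; floor = certified bounds/negative ranges.  Cell pub-namedobj (venture DiscreteObjects),
target (H) = `H(668)`, hadamard gen 30.  `ConferenceGraph333FixedSubgraph` treats one automorphism of PRIME order;
here the same idea for an arbitrary `p`-group `G` of automorphisms (in particular one automorphism of prime-power order):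
a `G`-invariant vertex set `S` satisfies `|S| ≡ |S ∩ Fix G| (mod p)` (Mathlib `IsPGroup.card_modEq_card_fixedPoints` on
the sub-action), applied to `S = V`, `S = N(x)` and `S = N(x) ∩ N(y)` for common fixed vertices `x, y`.
* `pgroup_card_modEq_card_fixed` (any `p`-group of permutations, any invariant finset; the fixed set `F` enters through
  `hF : y ∈ F ↔ ∀ g ∈ G, g y = y`), `sum01_eq_card_filter`, `exists_add_mul_of_modEq`.
* `pgroup_card_fixed_congr` (`|Fix G| + p·a = 333`), `pgroup_fixed_row_congr` (`Σ_{y ∈ Fix G} A_xy + p·a = 166`),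
  `pgroup_fixed_pair_congr` (`Σ_{z ∈ Fix G} A_xz A_zy + p·b = 83(1+[x=y]) − A_xy`) for `x, y ∈ Fix G`.
* cyclic case `G = ⟨σ⟩`, `σ^(p^e) = 1`: `isPGroup_zpowers_of_pow_eq_one`, `forall_zpowers_apply_eq_iff`,
  `zpowers_adj_invariant`, `aut_ppow_card_fixed_congr`, `aut_ppow_fixed_row_congr`, `aut_ppow_fixed_pair_congr`.
* `fixed_three_false` — `|F| = 3` with all `F`-degrees `≡ 166 (mod p)`, `p ∈ {3, 5}`: impossible (`1`-regular on `3` vertices).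
* **`no_aut_order_25`** — NO AUTOMORPHISM OF ORDER 25: `25·(f+1) ≤ 333` (gen 29 orbit bound), `f ≡ 333 (mod 5)`, `f` odd
  (gen 29) force `f = 3`, excluded by the fixed subgraph.  **`no_aut_order_81`** likewise (`81·(f+1) ≤ 333 ⇒ f = 3`).
  `no_aut_pow_eq_one_25`, `no_aut_pow_eq_one_81` (`σ^(25k) = 1 ⇒ σ^(5k) = 1`, `σ^(81k) = 1 ⇒ σ^(27k) = 1`).
* **`aut_order9_fixed`** (`σ^9 = 1 ≠ σ^3 ⇒ f ∈ {9, 15, 21, 27, 33}`), **`aut_order27_fixed`** (`σ^27 = 1 ≠ σ^9 ⇒ f = 9`).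
Consequence for the census: element orders `25, 50, 75, 81, 162, …` leave the admissible list; `5² ∣ |Aut|` only through
`(ℤ/5)²`.  METHOD IN PRINT: fixed substructures / orbit matrices of automorphism groups of designs and strongly regular graphs
(Behbahani–Lam 2011 and predecessors); instance and kernel proofs ours (PROVISIONAL).  WORDS: structure of a HYPOTHETICAL
object; no srg(333,166,82,83) / C(334) / H(668) is constructed or excluded.  No `sorry`, no new definitions.
-/

namespace Summit.Ventures.DiscreteObjects.Hadamard

open Finset

section pgroupFixed
variable {V : Type*} [Fintype V] [DecidableEq V]

/-- **`|S| ≡ |S ∩ Fix G| (mod p)`** for a `p`-group `G` of permutations, `F` its set of common fixed points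
(given by a membership characterisation, to keep statements free of decidability instances) and a `G`-invariant finset `S`. -/
theorem pgroup_card_modEq_card_fixed (G : Subgroup (Equiv.Perm V)) {p : ℕ} [Fact p.Prime]
    (hG : IsPGroup p G) (F : Finset V) (hF : ∀ y, y ∈ F ↔ ∀ g ∈ G, g y = y)
    (S : Finset V) (hS : ∀ g ∈ G, ∀ y ∈ S, g y ∈ S) :
    S.card ≡ (S ∩ F).card [MOD p] := by
  classical
  let T : SubMulAction G V :=
    { carrier := (S : Set V)
      smul_mem' := fun g y hy => by
        show (g : Equiv.Perm V) y ∈ (S : Set V)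
        exact Finset.mem_coe.mpr (hS g g.2 y (Finset.mem_coe.mp hy)) }
  have hmemT : ∀ y, y ∈ T ↔ y ∈ S := fun y => Finset.mem_coe
  have h := hG.card_modEq_card_fixedPoints T
  have e1 : T ≃ S := Equiv.subtypeEquivRight hmemT
  have h1 : Nat.card T = S.card := by
    rw [Nat.card_congr e1, Nat.card_eq_fintype_card, Fintype.card_coe]
  have e2 : MulAction.fixedPoints G T ≃ (S ∩ F : Finset V) :=
    { toFun := fun t => ⟨(t.1 : V), Finset.mem_inter.mpr ⟨(hmemT _).mp t.1.2, (hF _).mpr fun g hg =>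
          congrArg Subtype.val (t.2 ⟨g, hg⟩)⟩⟩
      invFun := fun y => ⟨⟨y.1, (hmemT _).mpr (Finset.mem_inter.mp y.2).1⟩,
          fun g => Subtype.ext ((hF _).mp (Finset.mem_inter.mp y.2).2 g g.2)⟩
      left_inv := fun t => rfl
      right_inv := fun y => rfl }
  have h2 : Nat.card (MulAction.fixedPoints G T) = (S ∩ F).card := by
    rw [Nat.card_congr e2, Nat.card_eq_fintype_card, Fintype.card_coe]
  rwa [h1, h2] at h

omit [Fintype V] [DecidableEq V] in
/-- a `0/1`-valued sum is the number of `1`s -/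
theorem sum01_eq_card_filter (f : V → ℤ) (h01 : ∀ y, f y = 0 ∨ f y = 1) (s : Finset V) :
    ∑ y ∈ s, f y = ((s.filter fun y => f y = 1).card : ℤ) := by
  rw [Finset.card_eq_sum_ones, Nat.cast_sum, Finset.sum_filter]
  refine Finset.sum_congr rfl fun y _ => ?_
  rcases h01 y with h | h <;> simp [h]

/-- from `n ≡ m (mod p)` with `m ≤ n` to `m + p·a = n` over `ℤ` -/
theorem exists_add_mul_of_modEq {p n m : ℕ} (h : n ≡ m [MOD p]) (hle : m ≤ n) :
    ∃ a : ℤ, (m : ℤ) + p * a = n := by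
  obtain ⟨c, hc⟩ := (Nat.modEq_iff_dvd' hle).mp h.symm
  refine ⟨c, ?_⟩
  zify [hle] at hc
  linarith

/-- **`|Fix G| + p·a = 333`** for a `p`-group `G` of permutations of the `333` vertices. -/
theorem pgroup_card_fixed_congr (hV : Fintype.card V = 333) (G : Subgroup (Equiv.Perm V)) {p : ℕ} [Fact p.Prime]
    (hG : IsPGroup p G) (F : Finset V) (hF : ∀ y, y ∈ F ↔ ∀ g ∈ G, g y = y) :
    ∃ a : ℤ, (F.card : ℤ) + p * a = 333 := by
  have h := pgroup_card_modEq_card_fixed G hG F hF univ (fun _ _ _ _ => Finset.mem_univ _)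
  rw [Finset.univ_inter, Finset.card_univ, hV] at h
  exact exists_add_mul_of_modEq h ((Finset.card_le_univ F).trans (le_of_eq hV))

/-- **Row congruence at a common fixed vertex of a `p`-group of automorphisms:**
`Σ_{y ∈ Fix G} A_xy + p·a = Σ_y A_xy`. -/
theorem pgroup_fixed_row_congr (A : Matrix V V ℤ) (h01 : ∀ x y, A x y = 0 ∨ A x y = 1)
    (G : Subgroup (Equiv.Perm V)) {p : ℕ} [Fact p.Prime] (hG : IsPGroup p G)
    (hGA : ∀ g ∈ G, ∀ x y, A (g x) (g y) = A x y) (F : Finset V) (hF : ∀ y, y ∈ F ↔ ∀ g ∈ G, g y = y)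
    {x : V} (hx : ∀ g ∈ G, g x = x) :
    ∃ a : ℤ, (∑ y ∈ F, A x y) + p * a = ∑ y, A x y := by
  set S := univ.filter fun y => A x y = 1 with hS_def
  have hS : ∀ g ∈ G, ∀ y ∈ S, g y ∈ S := by
    intro g hg y hy
    rw [hS_def, Finset.mem_filter] at hy ⊢
    refine ⟨Finset.mem_univ _, ?_⟩
    rw [← hy.2]
    conv_lhs => rw [← hx g hg]
    exact hGA g hg x y
  have h := pgroup_card_modEq_card_fixed G hG F hF S hS
  obtain ⟨a, ha⟩ := exists_add_mul_of_modEq h (Finset.card_le_card Finset.inter_subset_left)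
  refine ⟨a, ?_⟩
  have hSF : S ∩ F = F.filter fun y => A x y = 1 := by
    ext y; simp only [hS_def, Finset.mem_inter, Finset.mem_filter, Finset.mem_univ, true_and, and_comm]
  rw [sum01_eq_card_filter (fun y => A x y) (h01 x) univ, sum01_eq_card_filter (fun y => A x y) (h01 x) F, ← ha,
    hSF]

/-- **Pair congruence at two common fixed vertices:** `Σ_{z ∈ Fix G} A_xz A_zy + p·b = Σ_z A_xz A_zy`. -/
theorem pgroup_fixed_pair_congr (A : Matrix V V ℤ) (h01 : ∀ x y, A x y = 0 ∨ A x y = 1)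
    (G : Subgroup (Equiv.Perm V)) {p : ℕ} [Fact p.Prime] (hG : IsPGroup p G)
    (hGA : ∀ g ∈ G, ∀ x y, A (g x) (g y) = A x y) (F : Finset V) (hF : ∀ y, y ∈ F ↔ ∀ g ∈ G, g y = y)
    {x y : V} (hx : ∀ g ∈ G, g x = x) (hy : ∀ g ∈ G, g y = y) :
    ∃ b : ℤ, (∑ z ∈ F, A x z * A z y) + p * b = ∑ z, A x z * A z y := by
  have h01' : ∀ z, A x z * A z y = 0 ∨ A x z * A z y = 1 := fun z => by
    rcases h01 x z with h | h <;> rcases h01 z y with h' | h' <;> simp [h, h']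
  set S := univ.filter fun z => A x z * A z y = 1 with hS_def
  have hS : ∀ g ∈ G, ∀ z ∈ S, g z ∈ S := by
    intro g hg z hz
    rw [hS_def, Finset.mem_filter] at hz ⊢
    refine ⟨Finset.mem_univ _, ?_⟩
    rw [← hz.2]
    conv_lhs => rw [← hx g hg, ← hy g hg]
    rw [hGA g hg x z, hGA g hg z y]
  have h := pgroup_card_modEq_card_fixed G hG F hF S hS
  obtain ⟨b, hb⟩ := exists_add_mul_of_modEq h (Finset.card_le_card Finset.inter_subset_left)
  refine ⟨b, ?_⟩
  have hSF : S ∩ F = F.filter fun z => A x z * A z y = 1 := by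
    ext z; simp only [hS_def, Finset.mem_inter, Finset.mem_filter, Finset.mem_univ, true_and, and_comm]
  rw [sum01_eq_card_filter (fun z => A x z * A z y) h01' univ, sum01_eq_card_filter (fun z => A x z * A z y) h01' F,
    ← hb, hSF]

/-! ## One automorphism of prime-power order -/

omit [Fintype V] [DecidableEq V] in
/-- `σ^(p^e) = 1 ⇒ ⟨σ⟩` is a `p`-group. -/
theorem isPGroup_zpowers_of_pow_eq_one (σ : Equiv.Perm V) {p e : ℕ} (hσ : σ ^ (p ^ e) = 1) :
    IsPGroup p (Subgroup.zpowers σ) := by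
  intro g
  refine ⟨e, Subtype.ext ?_⟩
  obtain ⟨k, hk⟩ := Subgroup.mem_zpowers_iff.mp g.2
  show ((g : Equiv.Perm V)) ^ (p ^ e) = 1
  rw [← hk, ← zpow_natCast, ← zpow_mul, mul_comm, zpow_mul, zpow_natCast, hσ, one_zpow]

omit [Fintype V] [DecidableEq V] in
/-- the common fixed points of `⟨σ⟩` are the fixed points of `σ` -/
theorem forall_zpowers_apply_eq_iff (σ : Equiv.Perm V) (y : V) :
    (∀ g ∈ Subgroup.zpowers σ, g y = y) ↔ σ y = y := by
  constructor
  · exact fun h => h σ (Subgroup.mem_zpowers σ)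
  · intro h g hg
    obtain ⟨k, rfl⟩ := Subgroup.mem_zpowers_iff.mp hg
    exact Equiv.Perm.zpow_apply_eq_self_of_apply_eq_self h k

/-- membership characterisation of `Fix σ` as the common fixed points of `⟨σ⟩` -/
theorem mem_filter_fixed_iff_zpowers (σ : Equiv.Perm V) (y : V) :
    y ∈ (univ.filter fun y => σ y = y) ↔ ∀ g ∈ Subgroup.zpowers σ, g y = y := by
  rw [Finset.mem_filter, forall_zpowers_apply_eq_iff]; simp

/-- **`|Fix σ| + p·a = 333`** for `σ^(p^e) = 1`. -/
theorem aut_ppow_card_fixed_congr (hV : Fintype.card V = 333) (σ : Equiv.Perm V) {p e : ℕ} (hp : p.Prime)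
    (hσ : σ ^ (p ^ e) = 1) : ∃ a : ℤ, ((univ.filter fun y => σ y = y).card : ℤ) + p * a = 333 := by
  haveI := Fact.mk hp
  exact pgroup_card_fixed_congr hV (Subgroup.zpowers σ) (isPGroup_zpowers_of_pow_eq_one σ hσ) _
    (mem_filter_fixed_iff_zpowers σ)

omit [Fintype V] [DecidableEq V] in
/-- every element of `⟨σ⟩` preserves `A` if `σ` does -/
theorem zpowers_adj_invariant (A : Matrix V V ℤ) (σ : Equiv.Perm V) (hA : ∀ x y, A (σ x) (σ y) = A x y) :
    ∀ g ∈ Subgroup.zpowers σ, ∀ x y, A (g x) (g y) = A x y := by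
  intro g hg a b
  obtain ⟨k, rfl⟩ := Subgroup.mem_zpowers_iff.mp hg
  rcases Int.eq_nat_or_neg k with ⟨n, rfl | rfl⟩
  · rw [zpow_natCast]; exact adj_pow_invariant A σ hA n a b
  · rw [zpow_neg, zpow_natCast]
    have h := adj_pow_invariant A σ hA n ((σ ^ n)⁻¹ a) ((σ ^ n)⁻¹ b)
    simp only [Equiv.Perm.coe_inv, Equiv.apply_symm_apply] at h ⊢
    exact h.symm

/-- **Row congruence for `σ^(p^e) = 1`:** `Σ_{y ∈ Fix σ} A_xy + p·a = Σ_y A_xy` at a fixed vertex `x`. -/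
theorem aut_ppow_fixed_row_congr (A : Matrix V V ℤ) (h01 : ∀ x y, A x y = 0 ∨ A x y = 1)
    (σ : Equiv.Perm V) {p e : ℕ} (hp : p.Prime) (hσ : σ ^ (p ^ e) = 1) (hA : ∀ x y, A (σ x) (σ y) = A x y)
    {x : V} (hx : σ x = x) :
    ∃ a : ℤ, (∑ y ∈ univ.filter (fun y => σ y = y), A x y) + p * a = ∑ y, A x y := by
  haveI := Fact.mk hp
  exact pgroup_fixed_row_congr A h01 (Subgroup.zpowers σ) (isPGroup_zpowers_of_pow_eq_one σ hσ)
    (zpowers_adj_invariant A σ hA) _ (mem_filter_fixed_iff_zpowers σ) ((forall_zpowers_apply_eq_iff σ x).mpr hx)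

/-- **Pair congruence for `σ^(p^e) = 1`:** `Σ_{z ∈ Fix σ} A_xz A_zy + p·b = Σ_z A_xz A_zy` at fixed `x, y`. -/
theorem aut_ppow_fixed_pair_congr (A : Matrix V V ℤ) (h01 : ∀ x y, A x y = 0 ∨ A x y = 1)
    (σ : Equiv.Perm V) {p e : ℕ} (hp : p.Prime) (hσ : σ ^ (p ^ e) = 1) (hA : ∀ x y, A (σ x) (σ y) = A x y)
    {x y : V} (hx : σ x = x) (hy : σ y = y) :
    ∃ b : ℤ, (∑ z ∈ univ.filter (fun y => σ y = y), A x z * A z y) + p * b = ∑ z, A x z * A z y := by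
  haveI := Fact.mk hp
  exact pgroup_fixed_pair_congr A h01 (Subgroup.zpowers σ) (isPGroup_zpowers_of_pow_eq_one σ hσ)
    (zpowers_adj_invariant A σ hA) _ (mem_filter_fixed_iff_zpowers σ) ((forall_zpowers_apply_eq_iff σ x).mpr hx)
    ((forall_zpowers_apply_eq_iff σ y).mpr hy)

/-- **`|F| = 3` is impossible when every `F`-degree is `≡ 166 (mod p)`, `p ∈ {3, 5}`** (the degrees lie in `{0,1,2}`,
hence equal `1`: a `1`-regular graph on `3` vertices contradicts the handshake). -/
theorem fixed_three_false (A : Matrix V V ℤ) (h01 : ∀ x y, A x y = 0 ∨ A x y = 1) (hsymm : ∀ x y, A y x = A x y)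
    (hdiag : ∀ x, A x x = 0) (hk : ∀ x, ∑ y, A x y = 166) {p : ℕ} (hp' : p = 3 ∨ p = 5) (F : Finset V) (hF : F.card = 3)
    (hrow : ∀ x ∈ F, ∃ a : ℤ, (∑ y ∈ F, A x y) + p * a = ∑ y, A x y) : False := by
  have hS : ∀ x ∈ F, ∑ y ∈ F, A x y = 1 := by
    intro x hx
    obtain ⟨a, ha⟩ := hrow x hx
    rw [hk x] at ha
    obtain ⟨h0, h1⟩ := sum_adj_bounds A h01 hdiag F hx
    rw [hF] at h1
    rcases hp' with rfl | rfl <;> push_cast at ha h1 <;> omega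
  have hsum : ∑ x ∈ F, ∑ y ∈ F, A x y = 3 := by
    rw [Finset.sum_congr rfl hS, Finset.sum_const, hF]; norm_num
  have h2 := sum_sum_adj_even A hsymm hdiag F
  rw [hsum] at h2
  omega

/-- **NO AUTOMORPHISM OF ORDER 25** of an `srg(333,166,82,83)`. -/
theorem no_aut_order_25 (hV : Fintype.card V = 333) (A : Matrix V V ℤ)
    (h01 : ∀ x y, A x y = 0 ∨ A x y = 1) (hsymm : ∀ x y, A y x = A x y) (hdiag : ∀ x, A x x = 0)
    (hk : ∀ x, ∑ y, A x y = 166) (hsrg : ∀ x y, ∑ z, A x z * A z y = 83 * (1 + (if x = y then 1 else 0)) - A x y)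
    (σ : Equiv.Perm V) (hσ : σ ^ 25 = 1) (hσ5 : σ ^ 5 ≠ 1) (hA : ∀ x y, A (σ x) (σ y) = A x y) : False := by
  have hp : Nat.Prime 5 := by norm_num
  have hb := aut_prime_pow_order_bound hV A h01 hsymm hdiag hk hsrg σ hA hp 1 (by norm_num; exact hσ)
    (by norm_num; exact hσ5)
  obtain ⟨a, ha⟩ := aut_ppow_card_fixed_congr hV σ hp (e := 2) (by norm_num; exact hσ)
  obtain ⟨-, hodd⟩ := aut_card_fixed_odd hV A h01 hsymm hdiag hk hsrg σ hσ (by norm_num) hA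
  have hf : (univ.filter fun y => σ y = y).card = 3 := by push_cast at ha; omega
  exact fixed_three_false A h01 hsymm hdiag hk (Or.inr rfl) _ hf
    (fun x hx => aut_ppow_fixed_row_congr A h01 σ hp (e := 2) (by norm_num; exact hσ) hA (Finset.mem_filter.mp hx).2)

/-- **NO AUTOMORPHISM OF ORDER 81** of an `srg(333,166,82,83)`. -/
theorem no_aut_order_81 (hV : Fintype.card V = 333) (A : Matrix V V ℤ)
    (h01 : ∀ x y, A x y = 0 ∨ A x y = 1) (hsymm : ∀ x y, A y x = A x y) (hdiag : ∀ x, A x x = 0)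
    (hk : ∀ x, ∑ y, A x y = 166) (hsrg : ∀ x y, ∑ z, A x z * A z y = 83 * (1 + (if x = y then 1 else 0)) - A x y)
    (σ : Equiv.Perm V) (hσ : σ ^ 81 = 1) (hσ27 : σ ^ 27 ≠ 1) (hA : ∀ x y, A (σ x) (σ y) = A x y) : False := by
  have hp : Nat.Prime 3 := by norm_num
  have hb := aut_prime_pow_order_bound hV A h01 hsymm hdiag hk hsrg σ hA hp 3 (by norm_num; exact hσ)
    (by norm_num; exact hσ27)
  obtain ⟨a, ha⟩ := aut_ppow_card_fixed_congr hV σ hp (e := 4) (by norm_num; exact hσ)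
  obtain ⟨-, hodd⟩ := aut_card_fixed_odd hV A h01 hsymm hdiag hk hsrg σ hσ (by norm_num) hA
  have hf : (univ.filter fun y => σ y = y).card = 3 := by push_cast at ha; omega
  exact fixed_three_false A h01 hsymm hdiag hk (Or.inl rfl) _ hf
    (fun x hx => aut_ppow_fixed_row_congr A h01 σ hp (e := 4) (by norm_num; exact hσ) hA (Finset.mem_filter.mp hx).2)

/-- `σ^(25k) = 1 ⇒ σ^(5k) = 1` (no element of order divisible by `25`). -/
theorem no_aut_pow_eq_one_25 (hV : Fintype.card V = 333) (A : Matrix V V ℤ)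
    (h01 : ∀ x y, A x y = 0 ∨ A x y = 1) (hsymm : ∀ x y, A y x = A x y) (hdiag : ∀ x, A x x = 0)
    (hk : ∀ x, ∑ y, A x y = 166) (hsrg : ∀ x y, ∑ z, A x z * A z y = 83 * (1 + (if x = y then 1 else 0)) - A x y)
    (σ : Equiv.Perm V) {k : ℕ} (hσ : σ ^ (25 * k) = 1) (hA : ∀ x y, A (σ x) (σ y) = A x y) : σ ^ (5 * k) = 1 := by
  by_contra h
  have h25 : (σ ^ k) ^ 25 = 1 := by rw [← pow_mul, mul_comm]; exact hσ
  have h5 : (σ ^ k) ^ 5 ≠ 1 := by rw [← pow_mul, mul_comm]; exact h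
  exact no_aut_order_25 hV A h01 hsymm hdiag hk hsrg (σ ^ k) h25 h5 (adj_pow_invariant A σ hA k)

/-- `σ^(81k) = 1 ⇒ σ^(27k) = 1` (no element of order divisible by `81`). -/
theorem no_aut_pow_eq_one_81 (hV : Fintype.card V = 333) (A : Matrix V V ℤ)
    (h01 : ∀ x y, A x y = 0 ∨ A x y = 1) (hsymm : ∀ x y, A y x = A x y) (hdiag : ∀ x, A x x = 0)
    (hk : ∀ x, ∑ y, A x y = 166) (hsrg : ∀ x y, ∑ z, A x z * A z y = 83 * (1 + (if x = y then 1 else 0)) - A x y)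
    (σ : Equiv.Perm V) {k : ℕ} (hσ : σ ^ (81 * k) = 1) (hA : ∀ x y, A (σ x) (σ y) = A x y) : σ ^ (27 * k) = 1 := by
  by_contra h
  have h81 : (σ ^ k) ^ 81 = 1 := by rw [← pow_mul, mul_comm]; exact hσ
  have h27 : (σ ^ k) ^ 27 ≠ 1 := by rw [← pow_mul, mul_comm]; exact h
  exact no_aut_order_81 hV A h01 hsymm hdiag hk hsrg (σ ^ k) h81 h27 (adj_pow_invariant A σ hA k)

/-- **Order 9 ⇒ `f ∈ {9, 15, 21, 27, 33}`** (`9(f+1) ≤ 333`, `f ≡ 0 (mod 3)`, `f` odd, `f ≠ 3`). -/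
theorem aut_order9_fixed (hV : Fintype.card V = 333) (A : Matrix V V ℤ)
    (h01 : ∀ x y, A x y = 0 ∨ A x y = 1) (hsymm : ∀ x y, A y x = A x y) (hdiag : ∀ x, A x x = 0)
    (hk : ∀ x, ∑ y, A x y = 166) (hsrg : ∀ x y, ∑ z, A x z * A z y = 83 * (1 + (if x = y then 1 else 0)) - A x y)
    (σ : Equiv.Perm V) (hσ : σ ^ 9 = 1) (hσ3 : σ ^ 3 ≠ 1) (hA : ∀ x y, A (σ x) (σ y) = A x y) :
    let f := (univ.filter fun y => σ y = y).card
    f = 9 ∨ f = 15 ∨ f = 21 ∨ f = 27 ∨ f = 33 := by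
  intro f
  have hp : Nat.Prime 3 := by norm_num
  have hb := aut_prime_pow_order_bound hV A h01 hsymm hdiag hk hsrg σ hA hp 1 (by norm_num; exact hσ)
    (by norm_num; exact hσ3)
  obtain ⟨a, ha⟩ := aut_ppow_card_fixed_congr hV σ hp (e := 2) (by norm_num; exact hσ)
  obtain ⟨-, hodd⟩ := aut_card_fixed_odd hV A h01 hsymm hdiag hk hsrg σ hσ (by norm_num) hA
  have hne3 : (univ.filter fun y => σ y = y).card ≠ 3 := fun hf =>
    fixed_three_false A h01 hsymm hdiag hk (Or.inl rfl) _ hf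
      (fun x hx => aut_ppow_fixed_row_congr A h01 σ hp (e := 2) (by norm_num; exact hσ) hA (Finset.mem_filter.mp hx).2)
  push_cast at ha
  omega

/-- **Order 27 ⇒ `f = 9`** (`27(f+1) ≤ 333 ⇒ f ≤ 11`, `f ≡ 0 (mod 3)`, `f` odd, `f ≠ 3`). -/
theorem aut_order27_fixed (hV : Fintype.card V = 333) (A : Matrix V V ℤ)
    (h01 : ∀ x y, A x y = 0 ∨ A x y = 1) (hsymm : ∀ x y, A y x = A x y) (hdiag : ∀ x, A x x = 0)
    (hk : ∀ x, ∑ y, A x y = 166) (hsrg : ∀ x y, ∑ z, A x z * A z y = 83 * (1 + (if x = y then 1 else 0)) - A x y)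
    (σ : Equiv.Perm V) (hσ : σ ^ 27 = 1) (hσ9 : σ ^ 9 ≠ 1) (hA : ∀ x y, A (σ x) (σ y) = A x y) :
    (univ.filter fun y => σ y = y).card = 9 := by
  have hp : Nat.Prime 3 := by norm_num
  have hb := aut_prime_pow_order_bound hV A h01 hsymm hdiag hk hsrg σ hA hp 2 (by norm_num; exact hσ)
    (by norm_num; exact hσ9)
  obtain ⟨a, ha⟩ := aut_ppow_card_fixed_congr hV σ hp (e := 3) (by norm_num; exact hσ)
  obtain ⟨-, hodd⟩ := aut_card_fixed_odd hV A h01 hsymm hdiag hk hsrg σ hσ (by norm_num) hA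
  have hne3 : (univ.filter fun y => σ y = y).card ≠ 3 := fun hf =>
    fixed_three_false A h01 hsymm hdiag hk (Or.inl rfl) _ hf
      (fun x hx => aut_ppow_fixed_row_congr A h01 σ hp (e := 3) (by norm_num; exact hσ) hA (Finset.mem_filter.mp hx).2)
  push_cast at ha
  omega

end pgroupFixed

end Summit.Ventures.DiscreteObjects.Hadamard
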